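import Summits.ValiantsHypothesis.ValiantsHypothesis.Theorems.LacunarySymmetroidMatrixDescartesCensusDoorA34NodeForm

/-!
# `MatrixDescartes` census — DOOR A at `(3,4)`: TWIN ROWS — the hyperbolic twin of an R4 row, the Pythagorean twin of an R0 row,
# the rotation pencils of class R0 and the Wronskian of a twin pair

HONEST FRAMING.  Object-search cell `pub-symmetroid`, door-A seat `val-sym-door-p3` (g26); item stmt-ValiantsHypothesis-19980
`DoorA34 = PosRootLawAt 3 4 18` (route item `Theses.LacunarySymmetroid.DoorA34`) is OPEN and asserted nowhere in this file.
By `…NodeRows.doorA34_iff_nodeRows` the door is three explicit fewnomial row families on the node `K`-nomials: (R4) Cayley's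
`K_c(ℓ) = ∑ᵢ cᵢ∏_{j≠i}ℓⱼ`, (R2) `(p²+q²)(ℓ₀+ℓ₁) + 2pℓ₀ℓ₁`, (R0) `r(p²+q²) + p(r²+s²)`.  This file records, for ALL supports and all real
data and with no `def`, that every such row has a TWIN row of the same class on the same support, tied to it by a quadratic identity:

* R4 — THE HYPERBOLIC TWIN (`R4_sq_sub_twin_sq`).  Flipping the signs of one node in each pair of the pairing `{0,2}|{1,3}` gives the row
  `K̃ = K_c(−ℓ₀, ℓ₁, −ℓ₂, ℓ₃)` and  `K² − K̃² = 4 · ℓ₀ℓ₁ℓ₂ℓ₃ · (c₀ℓ₂ + c₂ℓ₀)(c₁ℓ₃ + c₃ℓ₁)`  — `e₄` times the two weighted CROSS SUMS of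
  the pairing (the `K`-nomials of `…NodeCrossSums`).  At a det-root `K̃² = −4e₄·σ₀₂σ₁₃` (`R4_twin_sq_of_root`): the chamber-free
  CROSS-SUM LAW `e₄ · σ₀₂ · σ₁₃ ≤ 0` for each of the two mixed pairings (`R4_crossSums_nonpos_of_root`; in the `2–2` chamber this is
  `…NodeCrossSums.crossSums_sign_law`) together with the MAGNITUDE of the twin at the root.  Every member `aK + bK̃` of the pencil is again a
  node row with weights `((a−b)c₀, (a+b)c₁, (a−b)c₂, (a+b)c₃)` (`R4_twin_pencil`): R4 rows come in hyperbolic pencils.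
* R0 — THE PYTHAGOREAN TWIN (`R0_sq_add_twin_sq`).  With `P = p + iq`, `R = r + is`, `S = P + R` the R0 row is `f = Re(S·P̄·R̄) =
  r(p²+q²) + p(r²+s²)` and its twin `f̃ = s(p²+q²) + q(r²+s²) = −Im(S·P̄·R̄)` is the R0 row of the swapped data;
  `f² + f̃² = ((p+r)² + (q+s)²)(p²+q²)(r²+s²)`.  Hence `|f| ≤ |S||P||R|` pointwise and AT A ROOT OF `f` THE TWIN HAS FULL MODULUS,
  `f̃² = |S|²|P|²|R|²` (`R0_twin_sq_of_root`): the twin vanishes at a root of `f` only where `P`, `R` or `P + R` vanishes as a vector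
  (`R0_twin_ne_zero_of_root`).  ROTATION PENCIL (`R0_rotation`): rotating both complex nodes by `α + iβ` gives
  `f(αp−βq, βp+αq, αr−βs, βr+αs) = (α²+β²)·(α·f − β·f̃)` — every combination `αf − βf̃` is an R0 row on the same support (up to the
  positive factor), so a bound for the class is a bound for the whole rotation pencil of each row.
* R2 — the flip twin (`R2_sq_sub_twin_sq`): `g = (p²+q²)(ℓ₀+ℓ₁) + 2pℓ₀ℓ₁`, `g̃ = 2pℓ₀ℓ₁ − (p²+q²)(ℓ₀+ℓ₁)` (the R2 row of `(−ℓ₀, −ℓ₁)`),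
  `g² − g̃² = 8·p·ℓ₀ℓ₁(ℓ₀+ℓ₁)(p²+q²)`; at a root `p·ℓ₀ℓ₁·(ℓ₀+ℓ₁) ≤ 0` (`R2_sign_law_of_root`).
* THE TWIN WRONSKIAN OF CLASS R0 (`R0_twin_wronskian`, a polynomial identity in the values `p,q,r,s` and derivative values
  `p',q',r',s'`): `f·f̃' − f'·f̃ = |S|²|R|²·(pq' − p'q) + |S|²|P|²·(rs' − r's) − |P|²|R|²·((p+r)(q'+s') − (p'+r')(q+s))` — the
  Wronskian of the twin pair is a combination, with the positive weights `|S|²|R|², |S|²|P|², |P|²|R|²`, of the three PLÜCKER Wronskians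
  `W(p,q)`, `W(r,s)`, `W(p+r,q+s)` of pairs of node `K`-nomials (six-term fewnomials on the exponents `d_l + d_m − 1`, at most `5` sign
  changes each).  Reading (paper, seat report `HOME/DOOR-A34-P3G26-REPORT.md` §3, NOT a theorem of this file): `f·f̃' − f'·f̃ = −|SPR|²·Θ'`
  for the continuous argument `Θ` of `S·P̄·R̄`; the total variation of `Θ` on `(0,∞)` is at most `9π` (each of `S, P, R` crosses every
  line through the origin at most `3` times), so the rotation AVERAGE of the root count over the pencil `αf − βf̃` is at most `9`, and on any
  interval where the three Plücker Wronskians give `Θ'` a fixed sign the zeros of `f` and `f̃` interlace.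

Nothing here bounds `ζ_sym(3,4)`; `DoorA34` stays OPEN; registers unchanged; nothing bears on `MatrixDescartes` (stmt-ValiantsHypothesis-18050)
or on `VP ≠ VNP`.  [folklore] `|zw| = |z||w|` and the split-complex analogue; Plücker relations; elementary (`ring`).
-/

-- `Summit.ValiantsHypothesis.ValiantsHypothesis.…` repeats a component by the D-0017 layout
-- (single-conjunct summit), which the `dupNamespace` linter flags; the name is mandated.
set_option linter.dupNamespace false

namespace Summit.ValiantsHypothesis.ValiantsHypothesis.Theorems.LacunarySymmetroidMatrixDescartes.Census.NodeTwins

/-! ## 1. Class R4: the hyperbolic twin and the cross sums -/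

/-- **THE HYPERBOLIC TWIN OF AN R4 ROW** (a `ring` identity).  With `K = c₀ℓ₁ℓ₂ℓ₃ + c₁ℓ₀ℓ₂ℓ₃ + c₂ℓ₀ℓ₁ℓ₃ + c₃ℓ₀ℓ₁ℓ₂` and the twin
`K̃ = K(−ℓ₀, ℓ₁, −ℓ₂, ℓ₃) = −c₀ℓ₁ℓ₂ℓ₃ + c₁ℓ₀ℓ₂ℓ₃ − c₂ℓ₀ℓ₁ℓ₃ + c₃ℓ₀ℓ₁ℓ₂`:
`K² − K̃² = 4 · ℓ₀ℓ₁ℓ₂ℓ₃ · (c₀ℓ₂ + c₂ℓ₀) · (c₁ℓ₃ + c₃ℓ₁)`. [folklore] -/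
theorem R4_sq_sub_twin_sq (c₀ c₁ c₂ c₃ ℓ₀ ℓ₁ ℓ₂ ℓ₃ : ℝ) :
    (c₀ * (ℓ₁ * ℓ₂ * ℓ₃) + c₁ * (ℓ₀ * ℓ₂ * ℓ₃) + c₂ * (ℓ₀ * ℓ₁ * ℓ₃) + c₃ * (ℓ₀ * ℓ₁ * ℓ₂)) ^ 2
        - (-(c₀ * (ℓ₁ * ℓ₂ * ℓ₃)) + c₁ * (ℓ₀ * ℓ₂ * ℓ₃) - c₂ * (ℓ₀ * ℓ₁ * ℓ₃) + c₃ * (ℓ₀ * ℓ₁ * ℓ₂)) ^ 2 =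
      4 * (ℓ₀ * ℓ₁ * ℓ₂ * ℓ₃) * ((c₀ * ℓ₂ + c₂ * ℓ₀) * (c₁ * ℓ₃ + c₃ * ℓ₁)) := by
  ring

/-- The twin IS the node sum of the flipped node values `(−ℓ₀, ℓ₁, −ℓ₂, ℓ₃)` with the same weights. [folklore] -/
theorem R4_twin_eq (c₀ c₁ c₂ c₃ ℓ₀ ℓ₁ ℓ₂ ℓ₃ : ℝ) :
    c₀ * (ℓ₁ * (-ℓ₂) * ℓ₃) + c₁ * ((-ℓ₀) * (-ℓ₂) * ℓ₃) + c₂ * ((-ℓ₀) * ℓ₁ * ℓ₃) + c₃ * ((-ℓ₀) * ℓ₁ * (-ℓ₂)) =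
      -(c₀ * (ℓ₁ * ℓ₂ * ℓ₃)) + c₁ * (ℓ₀ * ℓ₂ * ℓ₃) - c₂ * (ℓ₀ * ℓ₁ * ℓ₃) + c₃ * (ℓ₀ * ℓ₁ * ℓ₂) := by
  ring

/-- **At a det-root the twin squares to `−4e₄σ₀₂σ₁₃`.** [folklore] -/
theorem R4_twin_sq_of_root (c₀ c₁ c₂ c₃ ℓ₀ ℓ₁ ℓ₂ ℓ₃ : ℝ)
    (hK : c₀ * (ℓ₁ * ℓ₂ * ℓ₃) + c₁ * (ℓ₀ * ℓ₂ * ℓ₃) + c₂ * (ℓ₀ * ℓ₁ * ℓ₃) + c₃ * (ℓ₀ * ℓ₁ * ℓ₂) = 0) :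
    (-(c₀ * (ℓ₁ * ℓ₂ * ℓ₃)) + c₁ * (ℓ₀ * ℓ₂ * ℓ₃) - c₂ * (ℓ₀ * ℓ₁ * ℓ₃) + c₃ * (ℓ₀ * ℓ₁ * ℓ₂)) ^ 2 =
      -(4 * (ℓ₀ * ℓ₁ * ℓ₂ * ℓ₃) * ((c₀ * ℓ₂ + c₂ * ℓ₀) * (c₁ * ℓ₃ + c₃ * ℓ₁))) := by
  have h := R4_sq_sub_twin_sq c₀ c₁ c₂ c₃ ℓ₀ ℓ₁ ℓ₂ ℓ₃
  rw [hK] at h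
  linarith

/-- **CHAMBER-FREE CROSS-SUM LAW.**  At every det-root of an R4 row, `e₄ · σ₀₂ · σ₁₃ ≤ 0` for the weighted cross sums
`σ₀₂ = c₀ℓ₂ + c₂ℓ₀`, `σ₁₃ = c₁ℓ₃ + c₃ℓ₁` of the pairing `{0,2}|{1,3}` (and, relabelling, of `{0,3}|{1,2}`): in an even node chamber the two
cross sums have opposite signs, in an odd one the same sign.  (No weight sign needed: it is a square being non-negative.) [folklore] -/
theorem R4_crossSums_nonpos_of_root (c₀ c₁ c₂ c₃ ℓ₀ ℓ₁ ℓ₂ ℓ₃ : ℝ)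
    (hK : c₀ * (ℓ₁ * ℓ₂ * ℓ₃) + c₁ * (ℓ₀ * ℓ₂ * ℓ₃) + c₂ * (ℓ₀ * ℓ₁ * ℓ₃) + c₃ * (ℓ₀ * ℓ₁ * ℓ₂) = 0) :
    (ℓ₀ * ℓ₁ * ℓ₂ * ℓ₃) * ((c₀ * ℓ₂ + c₂ * ℓ₀) * (c₁ * ℓ₃ + c₃ * ℓ₁)) ≤ 0 := by
  have h := R4_twin_sq_of_root c₀ c₁ c₂ c₃ ℓ₀ ℓ₁ ℓ₂ ℓ₃ hK
  nlinarith [sq_nonneg (-(c₀ * (ℓ₁ * ℓ₂ * ℓ₃)) + c₁ * (ℓ₀ * ℓ₂ * ℓ₃) - c₂ * (ℓ₀ * ℓ₁ * ℓ₃) + c₃ * (ℓ₀ * ℓ₁ * ℓ₂))]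

/-- In an EVEN chamber (`e₄ > 0`) the cross sums of a mixed pairing have a non-positive product at every det-root. [folklore] -/
theorem R4_crossSums_nonpos_of_root_even (c₀ c₁ c₂ c₃ ℓ₀ ℓ₁ ℓ₂ ℓ₃ : ℝ) (he : 0 < ℓ₀ * ℓ₁ * ℓ₂ * ℓ₃)
    (hK : c₀ * (ℓ₁ * ℓ₂ * ℓ₃) + c₁ * (ℓ₀ * ℓ₂ * ℓ₃) + c₂ * (ℓ₀ * ℓ₁ * ℓ₃) + c₃ * (ℓ₀ * ℓ₁ * ℓ₂) = 0) :
    (c₀ * ℓ₂ + c₂ * ℓ₀) * (c₁ * ℓ₃ + c₃ * ℓ₁) ≤ 0 := by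
  have h := R4_crossSums_nonpos_of_root c₀ c₁ c₂ c₃ ℓ₀ ℓ₁ ℓ₂ ℓ₃ hK
  by_contra hc
  exact absurd h (not_le.mpr (mul_pos he (not_le.mp hc)))

/-- In an ODD chamber (`e₄ < 0`) the cross sums of a mixed pairing have a non-negative product at every det-root. [folklore] -/
theorem R4_crossSums_nonneg_of_root_odd (c₀ c₁ c₂ c₃ ℓ₀ ℓ₁ ℓ₂ ℓ₃ : ℝ) (he : ℓ₀ * ℓ₁ * ℓ₂ * ℓ₃ < 0)
    (hK : c₀ * (ℓ₁ * ℓ₂ * ℓ₃) + c₁ * (ℓ₀ * ℓ₂ * ℓ₃) + c₂ * (ℓ₀ * ℓ₁ * ℓ₃) + c₃ * (ℓ₀ * ℓ₁ * ℓ₂) = 0) :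
    0 ≤ (c₀ * ℓ₂ + c₂ * ℓ₀) * (c₁ * ℓ₃ + c₃ * ℓ₁) := by
  have h := R4_crossSums_nonpos_of_root c₀ c₁ c₂ c₃ ℓ₀ ℓ₁ ℓ₂ ℓ₃ hK
  by_contra hc
  exact absurd h (not_le.mpr (mul_pos_of_neg_of_neg he (not_le.mp hc)))

/-- **R4 rows come in hyperbolic pencils**: `a·K + b·K̃` is the node sum with weights `((a−b)c₀, (a+b)c₁, (a−b)c₂, (a+b)c₃)`. [folklore] -/
theorem R4_twin_pencil (a b c₀ c₁ c₂ c₃ ℓ₀ ℓ₁ ℓ₂ ℓ₃ : ℝ) :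
    a * (c₀ * (ℓ₁ * ℓ₂ * ℓ₃) + c₁ * (ℓ₀ * ℓ₂ * ℓ₃) + c₂ * (ℓ₀ * ℓ₁ * ℓ₃) + c₃ * (ℓ₀ * ℓ₁ * ℓ₂))
        + b * (-(c₀ * (ℓ₁ * ℓ₂ * ℓ₃)) + c₁ * (ℓ₀ * ℓ₂ * ℓ₃) - c₂ * (ℓ₀ * ℓ₁ * ℓ₃) + c₃ * (ℓ₀ * ℓ₁ * ℓ₂)) =
      (a - b) * c₀ * (ℓ₁ * ℓ₂ * ℓ₃) + (a + b) * c₁ * (ℓ₀ * ℓ₂ * ℓ₃) + (a - b) * c₂ * (ℓ₀ * ℓ₁ * ℓ₃)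
        + (a + b) * c₃ * (ℓ₀ * ℓ₁ * ℓ₂) := by
  ring

/-! ## 2. Class R0: the Pythagorean twin and the rotation pencil -/

/-- **THE PYTHAGOREAN TWIN OF AN R0 ROW** (a `ring` identity).  With `f = r(p²+q²) + p(r²+s²)` (`= Re(S·P̄·R̄)`, `P = p+iq`, `R = r+is`,
`S = P+R`) and `f̃ = s(p²+q²) + q(r²+s²)` (`= −Im(S·P̄·R̄)`, the R0 row of the swapped data):
`f² + f̃² = ((p+r)² + (q+s)²) · (p²+q²) · (r²+s²)` (`= |S|²|P|²|R|²`). [folklore] -/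
theorem R0_sq_add_twin_sq (p q r s : ℝ) :
    (r * (p ^ 2 + q ^ 2) + p * (r ^ 2 + s ^ 2)) ^ 2 + (s * (p ^ 2 + q ^ 2) + q * (r ^ 2 + s ^ 2)) ^ 2 =
      ((p + r) ^ 2 + (q + s) ^ 2) * (p ^ 2 + q ^ 2) * (r ^ 2 + s ^ 2) := by
  ring

/-- Pointwise bound: `f² ≤ |S|²|P|²|R|²`. [folklore] -/
theorem R0_sq_le (p q r s : ℝ) :
    (r * (p ^ 2 + q ^ 2) + p * (r ^ 2 + s ^ 2)) ^ 2 ≤ ((p + r) ^ 2 + (q + s) ^ 2) * (p ^ 2 + q ^ 2) * (r ^ 2 + s ^ 2) := by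
  rw [← R0_sq_add_twin_sq]
  nlinarith [sq_nonneg (s * (p ^ 2 + q ^ 2) + q * (r ^ 2 + s ^ 2))]

/-- **At a root of `f` the twin has full modulus**: `f̃² = |S|²|P|²|R|²`. [folklore] -/
theorem R0_twin_sq_of_root (p q r s : ℝ) (hf : r * (p ^ 2 + q ^ 2) + p * (r ^ 2 + s ^ 2) = 0) :
    (s * (p ^ 2 + q ^ 2) + q * (r ^ 2 + s ^ 2)) ^ 2 = ((p + r) ^ 2 + (q + s) ^ 2) * (p ^ 2 + q ^ 2) * (r ^ 2 + s ^ 2) := by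
  rw [← R0_sq_add_twin_sq, hf]
  ring

/-- A sum of two real squares vanishes only if both do. -/
theorem sq_add_sq_pos_of_ne {a b : ℝ} (h : a ≠ 0 ∨ b ≠ 0) : 0 < a ^ 2 + b ^ 2 := by
  rcases h with h | h
  · have := sq_nonneg b; positivity
  · have := sq_nonneg a; positivity

/-- **The twin does not vanish at a root of `f`** unless one of the vectors `P = (p,q)`, `R = (r,s)`, `S = (p+r, q+s)` vanishes there:
the zero sets of an R0 row and of its twin are disjoint off the common-zero locus of the node pairs. [folklore] -/
theorem R0_twin_ne_zero_of_root (p q r s : ℝ) (hP : p ≠ 0 ∨ q ≠ 0) (hR : r ≠ 0 ∨ s ≠ 0) (hS : p + r ≠ 0 ∨ q + s ≠ 0)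
    (hf : r * (p ^ 2 + q ^ 2) + p * (r ^ 2 + s ^ 2) = 0) :
    s * (p ^ 2 + q ^ 2) + q * (r ^ 2 + s ^ 2) ≠ 0 := by
  intro h0
  have h := R0_twin_sq_of_root p q r s hf
  rw [h0] at h
  have hpos : 0 < ((p + r) ^ 2 + (q + s) ^ 2) * (p ^ 2 + q ^ 2) * (r ^ 2 + s ^ 2) :=
    mul_pos (mul_pos (sq_add_sq_pos_of_ne hS) (sq_add_sq_pos_of_ne hP)) (sq_add_sq_pos_of_ne hR)
  have : (0 : ℝ) ^ 2 = 0 := by norm_num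
  linarith

/-- **ROTATION PENCIL OF CLASS R0** (a `ring` identity).  Rotating both complex nodes by `α + iβ`:
`f(αp−βq, βp+αq, αr−βs, βr+αs) = (α²+β²)·(α·f − β·f̃)` — every combination `αf − βf̃` of an R0 row and its twin is, up to the positive
factor `α² + β²`, the R0 row of rotated data on the same support. [folklore] -/
theorem R0_rotation (α β p q r s : ℝ) :
    (α * r - β * s) * ((α * p - β * q) ^ 2 + (β * p + α * q) ^ 2)
        + (α * p - β * q) * ((α * r - β * s) ^ 2 + (β * r + α * s) ^ 2) =
      (α ^ 2 + β ^ 2) * (α * (r * (p ^ 2 + q ^ 2) + p * (r ^ 2 + s ^ 2)) - β * (s * (p ^ 2 + q ^ 2) + q * (r ^ 2 + s ^ 2))) := by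
  ring

/-- The quarter turn: rotating by `i` turns the row into MINUS ITS TWIN — the twin is itself an R0 row on the same support. [folklore] -/
theorem R0_quarter_turn (p q r s : ℝ) :
    (-s) * ((-q) ^ 2 + p ^ 2) + (-q) * ((-s) ^ 2 + r ^ 2) = -(s * (p ^ 2 + q ^ 2) + q * (r ^ 2 + s ^ 2)) := by
  ring

/-! ## 3. Class R2: the flip twin -/

/-- **THE FLIP TWIN OF AN R2 ROW** (a `ring` identity).  With `g = (p²+q²)(ℓ₀+ℓ₁) + 2pℓ₀ℓ₁` and `g̃ = 2pℓ₀ℓ₁ − (p²+q²)(ℓ₀+ℓ₁)`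
(minus the R2 row of the flipped real nodes `(−ℓ₀, −ℓ₁)`): `g² − g̃² = 8·p·ℓ₀ℓ₁·(ℓ₀+ℓ₁)·(p²+q²)`. [folklore] -/
theorem R2_sq_sub_twin_sq (p q ℓ₀ ℓ₁ : ℝ) :
    ((p ^ 2 + q ^ 2) * (ℓ₀ + ℓ₁) + 2 * p * ℓ₀ * ℓ₁) ^ 2 - (2 * p * ℓ₀ * ℓ₁ - (p ^ 2 + q ^ 2) * (ℓ₀ + ℓ₁)) ^ 2 =
      8 * p * (ℓ₀ * ℓ₁) * (ℓ₀ + ℓ₁) * (p ^ 2 + q ^ 2) := by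
  ring

/-- The flip twin is (minus) the R2 row of `(−ℓ₀, −ℓ₁)`. [folklore] -/
theorem R2_twin_eq (p q ℓ₀ ℓ₁ : ℝ) :
    (p ^ 2 + q ^ 2) * (-ℓ₀ + -ℓ₁) + 2 * p * (-ℓ₀) * (-ℓ₁) = 2 * p * ℓ₀ * ℓ₁ - (p ^ 2 + q ^ 2) * (ℓ₀ + ℓ₁) := by
  ring

/-- **R2 SIGN LAW AT A ROOT**: `p · ℓ₀ℓ₁ · (ℓ₀+ℓ₁) · (p²+q²) ≤ 0`, i.e. (off `P = 0`) the real part `p` of the complex node, the product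
`ℓ₀ℓ₁` and the sum `ℓ₀ + ℓ₁` of the real nodes cannot all have the same sign at a root. [folklore] -/
theorem R2_sign_law_of_root (p q ℓ₀ ℓ₁ : ℝ) (hg : (p ^ 2 + q ^ 2) * (ℓ₀ + ℓ₁) + 2 * p * ℓ₀ * ℓ₁ = 0) :
    p * (ℓ₀ * ℓ₁) * (ℓ₀ + ℓ₁) * (p ^ 2 + q ^ 2) ≤ 0 := by
  have h := R2_sq_sub_twin_sq p q ℓ₀ ℓ₁
  rw [hg] at h
  nlinarith [sq_nonneg (2 * p * ℓ₀ * ℓ₁ - (p ^ 2 + q ^ 2) * (ℓ₀ + ℓ₁))]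

/-! ## 4. The Wronskian of an R0 twin pair -/

/-- **THE TWIN WRONSKIAN OF CLASS R0** (a polynomial identity in the values `p, q, r, s` and the derivative values `p', q', r', s'`; by the
chain rule `f' = r'(p²+q²) + 2r(pp'+qq') + p'(r²+s²) + 2p(rr'+ss')` and likewise `f̃'`):
`f·f̃' − f'·f̃ = |S|²|R|²·(pq' − p'q) + |S|²|P|²·(rs' − r's) − |P|²|R|²·((p+r)(q'+s') − (p'+r')(q+s))`,
a combination with the POSITIVE weights `|S|²|R|², |S|²|P|², |P|²|R|²` of the three Plücker Wronskians `W(p,q)`, `W(r,s)`, `W(p+r, q+s)`.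
[folklore] -/
theorem R0_twin_wronskian (p q r s p' q' r' s' : ℝ) :
    (r * (p ^ 2 + q ^ 2) + p * (r ^ 2 + s ^ 2))
          * (s' * (p ^ 2 + q ^ 2) + s * (2 * p * p' + 2 * q * q') + q' * (r ^ 2 + s ^ 2) + q * (2 * r * r' + 2 * s * s'))
        - (r' * (p ^ 2 + q ^ 2) + r * (2 * p * p' + 2 * q * q') + p' * (r ^ 2 + s ^ 2) + p * (2 * r * r' + 2 * s * s'))
          * (s * (p ^ 2 + q ^ 2) + q * (r ^ 2 + s ^ 2)) =
      ((p + r) ^ 2 + (q + s) ^ 2) * (r ^ 2 + s ^ 2) * (p * q' - p' * q)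
        + ((p + r) ^ 2 + (q + s) ^ 2) * (p ^ 2 + q ^ 2) * (r * s' - r' * s)
        - (p ^ 2 + q ^ 2) * (r ^ 2 + s ^ 2) * ((p + r) * (q' + s') - (p' + r') * (q + s)) := by
  ring

/-- **Fold-free sign criterion.**  Where `W(p,q) ≥ 0`, `W(r,s) ≥ 0` and `W(p+r,q+s) ≤ 0` the twin Wronskian `f·f̃' − f'·f̃` is `≥ 0`
(the argument of `S·P̄·R̄` is monotone there; the mirror statement with all signs reversed holds likewise). [folklore] -/
theorem R0_twin_wronskian_nonneg (p q r s p' q' r' s' : ℝ) (h₁ : 0 ≤ p * q' - p' * q) (h₂ : 0 ≤ r * s' - r' * s)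
    (h₃ : (p + r) * (q' + s') - (p' + r') * (q + s) ≤ 0) :
    0 ≤ (r * (p ^ 2 + q ^ 2) + p * (r ^ 2 + s ^ 2))
          * (s' * (p ^ 2 + q ^ 2) + s * (2 * p * p' + 2 * q * q') + q' * (r ^ 2 + s ^ 2) + q * (2 * r * r' + 2 * s * s'))
        - (r' * (p ^ 2 + q ^ 2) + r * (2 * p * p' + 2 * q * q') + p' * (r ^ 2 + s ^ 2) + p * (2 * r * r' + 2 * s * s'))
          * (s * (p ^ 2 + q ^ 2) + q * (r ^ 2 + s ^ 2)) := by
  rw [R0_twin_wronskian]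
  have hS : 0 ≤ (p + r) ^ 2 + (q + s) ^ 2 := by positivity
  have hP : 0 ≤ p ^ 2 + q ^ 2 := by positivity
  have hR : 0 ≤ r ^ 2 + s ^ 2 := by positivity
  have t₁ : 0 ≤ ((p + r) ^ 2 + (q + s) ^ 2) * (r ^ 2 + s ^ 2) * (p * q' - p' * q) := mul_nonneg (mul_nonneg hS hR) h₁
  have t₂ : 0 ≤ ((p + r) ^ 2 + (q + s) ^ 2) * (p ^ 2 + q ^ 2) * (r * s' - r' * s) := mul_nonneg (mul_nonneg hS hP) h₂
  have t₃ : (p ^ 2 + q ^ 2) * (r ^ 2 + s ^ 2) * ((p + r) * (q' + s') - (p' + r') * (q + s)) ≤ 0 :=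
    mul_nonpos_of_nonneg_of_nonpos (mul_nonneg hP hR) h₃
  linarith

end Summit.ValiantsHypothesis.ValiantsHypothesis.Theorems.LacunarySymmetroidMatrixDescartes.Census.NodeTwins
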